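import Summits.KontsevichZagierPeriods.KontsevichZagierPeriods.Theorems.RootDecompRelativeModAbsoluteAngleFoldP2

/-! # `RootDecompRelativeModAbsoluteAngleFoldP3` — part 3/9 of the mechanical ≤400-line split of `af_src.lean` (sha256 2a2742458ba4dd14…)
Source: decomp-kz lens-3 g14 AngleFold.lean @5fd37862 (lint-fixed copy @30e24be4 by writer g8 per critic g6-12): ANGLE ADDITION IN FAMILIES — angleCellwiseFoldAt_one : AngleCellwiseFoldAt 1 PROVED (critic CLEARED g6-12 l.1335); --supports stmt-KontsevichZagierPeriods-30572.
Split by census-1 g10 `gen/splitlean.py`: scopes re-opened with their `open`/`variable`/`set_option` context; mathematics and declaration order unchanged. -/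

noncomputable section
open Set MeasureTheory
open Literature.NumberTheory.Transcendental Literature.ModelTheory.ExponentialFields
namespace Summit.KontsevichZagierPeriods.RootDecompRelativeModAbsolute.Rung30571.RegularisedLogLayer.CylLog.Leaf.G13
namespace AngleFold

/-- Reduction to an independent subfamily: if `p_j = Σ_{s ∈ T} c_s v_sj` pointwise with integer vectors `v_s`, then
`p_j = Σ_{t ∈ T'} (Σ_{j'} β_tj' p_j') v_tj` for some `T' ⊆ T`-sized set and rational `β` (the coefficients become
rational combinations of the `p_j` themselves). -/
theorem exists_rational_coefficients {ι : Type*} [Fintype ι] [DecidableEq ι] {X : Type*} {S : ℕ}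
    (v : Fin S → ι → ℤ) (p : ι → X → ℝ) :
    ∀ (n : ℕ) (T : Finset (Fin S)), T.card ≤ n → (∃ c : Fin S → X → ℝ, ∀ j x, p j x = ∑ s ∈ T, c s x * (v s j : ℝ)) →
      ∃ (T' : Finset (Fin S)) (β : Fin S → ι → ℚ),
        ∀ j x, p j x = ∑ t ∈ T', (∑ j', (β t j' : ℝ) * p j' x) * (v t j : ℝ) := by
  classical
  intro n
  induction n with
  | zero =>
    intro T hT ⟨c, hc⟩
    have hT0 : T = ∅ := Finset.card_eq_zero.1 (Nat.le_zero.1 hT)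
    subst hT0
    exact ⟨∅, fun _ _ => 0, fun j x => by simpa using hc j x⟩
  | succ n ih =>
    intro T hT ⟨c, hc⟩
    by_cases hind : ∀ μ : Fin S → ℚ, (∀ s, s ∉ T → μ s = 0) → (∀ j, ∑ s, μ s * (v s j : ℚ) = 0) → ∀ s, μ s = 0
    · -- independent: read the coefficients off with a rational left inverse
      obtain ⟨β, hβ0, hβ⟩ := exists_leftInv (fun s j => (v s j : ℚ)) T hind
      refine ⟨T, β, fun j x => ?_⟩
      rw [hc j x]
      refine Finset.sum_congr rfl fun t ht => ?_
      congr 1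
      symm
      -- `Σ_{j'} β_t j' p_j' x = c_t x`
      have : ∑ j', (β t j' : ℝ) * p j' x = ∑ s ∈ T, c s x * ∑ j', (β t j' : ℝ) * (v s j' : ℝ) := by
        calc ∑ j', (β t j' : ℝ) * p j' x = ∑ j', ∑ s ∈ T, (β t j' : ℝ) * (c s x * (v s j' : ℝ)) := by
              refine Finset.sum_congr rfl fun j' _ => ?_
              rw [hc j' x, Finset.mul_sum]
          _ = ∑ s ∈ T, ∑ j', (β t j' : ℝ) * (c s x * (v s j' : ℝ)) := Finset.sum_comm
          _ = _ := by
              refine Finset.sum_congr rfl fun s _ => ?_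
              rw [Finset.mul_sum]
              exact Finset.sum_congr rfl fun j' _ => by ring
      rw [this]
      have hδ : ∀ s ∈ T, ∑ j', (β t j' : ℝ) * (v s j' : ℝ) = if t = s then 1 else 0 := fun s hs => by
        have h := hβ t ht s hs
        split_ifs at h ⊢ <;> exact_mod_cast h
      rw [Finset.sum_congr rfl fun s hs => by rw [hδ s hs]]
      simp only [mul_ite, mul_one, mul_zero, Finset.sum_ite_eq, if_pos ht]
    · -- dependent: eliminate one vector and recurse
      push Not at hind
      obtain ⟨μ, hμT, hμ, s₁, hs₁⟩ := hind
      have hs₁T : s₁ ∈ T := by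
        by_contra h; exact hs₁ (hμT s₁ h)
      have hμR : ∀ j, ∑ s ∈ T, (μ s : ℝ) * (v s j : ℝ) = 0 := fun j => by
        have h1 := hμ j
        rw [← Finset.sum_subset (Finset.subset_univ T) fun s _ hs => by rw [hμT s hs, zero_mul]] at h1
        exact_mod_cast h1
      refine ih (T.erase s₁) (by rw [Finset.card_erase_of_mem hs₁T]; omega)
        ⟨fun s x => c s x - c s₁ x * (μ s : ℝ) / (μ s₁ : ℝ), fun j x => ?_⟩
      have hμ1 : (μ s₁ : ℝ) ≠ 0 := by exact_mod_cast hs₁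
      have hsplit := Finset.sum_erase_add T (fun s => (μ s : ℝ) * (v s j : ℝ)) hs₁T
      have hsplit' := Finset.sum_erase_add T (fun s => c s x * (v s j : ℝ)) hs₁T
      rw [hμR j] at hsplit
      rw [hc j x, ← hsplit']
      have : ∑ s ∈ T.erase s₁, (c s x - c s₁ x * (μ s : ℝ) / (μ s₁ : ℝ)) * (v s j : ℝ)
          = ∑ s ∈ T.erase s₁, c s x * (v s j : ℝ)
            - c s₁ x / (μ s₁ : ℝ) * ∑ s ∈ T.erase s₁, (μ s : ℝ) * (v s j : ℝ) := by
        rw [Finset.mul_sum, ← Finset.sum_sub_distrib]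
        refine Finset.sum_congr rfl fun s _ => by ring
      rw [this]
      have hrest : ∑ s ∈ T.erase s₁, (μ s : ℝ) * (v s j : ℝ) = -((μ s₁ : ℝ) * (v s₁ j : ℝ)) := by linarith
      rw [hrest]
      field_simp
      ring

/-- Homogenising the budget: from `Σ_j f'_sj θ_j = m_s π`, `Σ_s q'_s m_s = 0`, `p_j = Σ_s q'_s f'_sj` to EXACT integer
relations `Σ_j v_sj θ_j = 0` with `p_j = Σ_s c_s v_sj`. -/
theorem exists_homogenise {ι : Type*} [Fintype ι] {X : Type*} {S : ℕ} (θ : ι → ℝ) (f' : Fin S → ι → ℤ)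
    (mS : Fin S → ℚ) (q' : Fin S → X → ℝ) (p : ι → X → ℝ)
    (hrel : ∀ s, ∑ j, (f' s j : ℝ) * θ j = (mS s : ℝ) * Real.pi) (hbud : ∀ x, ∑ s, q' s x * (mS s : ℝ) = 0)
    (hp : ∀ j x, p j x = ∑ s, q' s x * (f' s j : ℝ)) :
    ∃ (v : Fin S → ι → ℤ) (c : Fin S → X → ℝ),
      (∀ s, ∑ j, (v s j : ℝ) * θ j = 0) ∧ ∀ j x, p j x = ∑ s, c s x * (v s j : ℝ) := by
  classical
  by_cases hm : ∀ s, mS s = 0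
  · exact ⟨f', q', fun s => by rw [hrel s, hm s]; simp, hp⟩
  push Not at hm
  obtain ⟨s₀, hs₀⟩ := hm
  -- `ρ_s = m_s / m_{s₀}`, `v_s = den(ρ_s) f'_s − num(ρ_s) f'_{s₀}`, `c_s = q'_s / den(ρ_s)`
  set ρ : Fin S → ℚ := fun s => mS s / mS s₀ with hρ
  have hnum : ∀ s, ((ρ s).num : ℝ) = (ρ s : ℝ) * ((ρ s).den : ℝ) := fun s => by
    have h := Rat.mul_den_eq_num (ρ s)
    exact_mod_cast h.symm
  have hden : ∀ s, ((ρ s).den : ℝ) ≠ 0 := fun s => by exact_mod_cast (ρ s).den_ne_zero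
  have hm0 : (mS s₀ : ℝ) ≠ 0 := by exact_mod_cast hs₀
  have hρm : ∀ s, (ρ s : ℝ) * (mS s₀ : ℝ) = (mS s : ℝ) := fun s => by
    rw [hρ]; push_cast; field_simp
  refine ⟨fun s j => ((ρ s).den : ℤ) * f' s j - (ρ s).num * f' s₀ j, fun s x => q' s x / ((ρ s).den : ℝ),
    fun s => ?_, fun j x => ?_⟩
  · have key : ∀ j, (((((ρ s).den : ℤ) * f' s j - (ρ s).num * f' s₀ j : ℤ)) : ℝ) * θ j
        = ((ρ s).den : ℝ) * ((f' s j : ℝ) * θ j) - ((ρ s).num : ℝ) * ((f' s₀ j : ℝ) * θ j) := fun j => by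
      push_cast; ring
    simp_rw [key]
    rw [Finset.sum_sub_distrib, ← Finset.mul_sum, ← Finset.mul_sum, hrel, hrel, hnum s]
    calc ((ρ s).den : ℝ) * ((mS s : ℝ) * Real.pi) - (ρ s : ℝ) * ((ρ s).den : ℝ) * ((mS s₀ : ℝ) * Real.pi)
        = ((ρ s).den : ℝ) * Real.pi * ((mS s : ℝ) - (ρ s : ℝ) * (mS s₀ : ℝ)) := by ring
      _ = 0 := by rw [hρm s, sub_self, mul_zero]
  · push_cast
    simp_rw [mul_sub, Finset.sum_sub_distrib]
    have h1 : ∑ s, q' s x / ((ρ s).den : ℝ) * (((ρ s).den : ℝ) * (f' s j : ℝ)) = ∑ s, q' s x * (f' s j : ℝ) :=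
      Finset.sum_congr rfl fun s _ => by field_simp
    have h2 : ∑ s, q' s x / ((ρ s).den : ℝ) * (((ρ s).num : ℝ) * (f' s₀ j : ℝ))
        = (∑ s, q' s x * (mS s : ℝ)) / (mS s₀ : ℝ) * (f' s₀ j : ℝ) := by
      rw [Finset.sum_div, Finset.sum_mul]
      refine Finset.sum_congr rfl fun s _ => ?_
      rw [hnum s, ← hρm s]
      field_simp
    rw [h1, h2, hbud x, zero_div, zero_mul, sub_zero, hp j x]

/-! ### §C4 The constant-data angle fold with budget (CAF*). -/

/-- **CAF\* (positive constants).** Honest monomials `V_j = [band T 0 d_j, p_j/(1+t²)]` with constants `d_j > 0` whose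
coefficients carry angle relations `Σ_j f'_sj arctan d_j = m_s π` with budget `Σ_s q'_s m_s = 0` and
`p_j = Σ_s q'_s f'_sj` sum to a KZ relation. -/
theorem constAngleFold_pos {m : ℕ} {T : Set (Fin m → ℝ)} (hT : IsSemialgebraic ℚ T) {ι : Type*} [Fintype ι]
    [DecidableEq ι] (d : ι → ℝ) (p : ι → (Fin m → ℝ) → ℝ) (V : ι → KZ.IntegralRep (m + 1))
    (hd : ∀ j, 0 < d j) (hds : ∀ j, SaConst T (d j)) (hp : ∀ j, IsSemialgebraicFunOn ℚ T (p j))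
    (hVd : ∀ j, (V j).domain = KZlog.band T (fun _ => 0) (fun _ => d j))
    (hVi : ∀ j, EqOn (V j).integrand (fun z => p j (Fin.init z) / (1 + z (Fin.last m) ^ 2)) (V j).domain)
    {S : ℕ} (f' : Fin S → ι → ℤ) (mS : Fin S → ℚ) (q' : Fin S → (Fin m → ℝ) → ℝ)
    (hrel : ∀ s, ∑ j, (f' s j : ℝ) * Real.arctan (d j) = (mS s : ℝ) * Real.pi)
    (hbud : ∀ x ∈ T, ∑ s, q' s x * (mS s : ℝ) = 0)
    (hpq : ∀ j, ∀ x ∈ T, p j x = ∑ s, q' s x * (f' s j : ℝ)) :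
    ∑ j, KZ.of (V j) ∈ KZ.relations := by
  classical
  -- integrability of the coefficients
  have hpi : ∀ j, IntegrableOn (p j) T := fun j => integrableOn_coeff_of_honest hT (hp j) (hd j) (V j) (hVd j) (hVi j)
  -- linear algebra on the points of `T`
  obtain ⟨v, c, hv, hc⟩ := exists_homogenise (X := T) (fun j => Real.arctan (d j)) f' mS (fun s x => q' s x)
    (fun j x => p j x) hrel (fun x => hbud x x.2) (fun j x => hpq j x x.2)
  obtain ⟨T', β, hβ⟩ := exists_rational_coefficients (X := T) v (fun j x => p j x) S Finset.univ
    (Finset.card_univ.le.trans (by simp)) ⟨c, fun j x => by simpa using hc j x⟩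
  -- the integrable coefficients `κ_t = Σ_{j'} β_tj' p_j'`, indexed by `Fin r` after enumerating `T'`
  set r := T'.card with hr
  let e : Fin r ≃ T' := (T'.equivFin).symm
  let κ : Fin r → (Fin m → ℝ) → ℝ := fun i x => ∑ j', (β (e i) j' : ℝ) * p j' x
  have hκ : ∀ i, IsSemialgebraicFunOn ℚ T (κ i) := fun i =>
    KZ.isSemialgebraicFunOn_finset_sum _ hT fun j' _ =>
      IsSemialgebraicFunOn.mul_holds ((isSemialgebraicFunOn_ratCast hT (β (e i) j')).congr fun _ _ => rfl) (hp j')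
  have hκi : ∀ i, IntegrableOn (κ i) T := fun i =>
    integrable_finsetSum _ fun j' _ => (hpi j').const_mul _
  let g : Fin r → ι → ℤ := fun i j => v (e i) j
  -- each class is the corresponding integer combination
  have hcl : ∀ j, cl (V j) = ∑ i, g i j • (⟨T, κ i, hT, hκ i, hκi i⟩ : Base m).A (d j) := fun j =>
    cl_eq_sum_smul_A hT κ hκ hκi (hd j).le (hds j) (fun i => g i j) (V j) (hVd j) fun z hz => by
      rw [hVi j hz]
      have hx : Fin.init z ∈ T := by
        have := hz; rw [hVd j] at this; exact (KZlog.mem_band.1 this).1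
      show p j (Fin.init z) / (1 + z (Fin.last m) ^ 2) = (∑ i, (g i j : ℝ) * κ i (Fin.init z)) / (1 + z (Fin.last m) ^ 2)
      congr 1
      have hβ' := hβ j ⟨Fin.init z, hx⟩
      dsimp only at hβ'
      rw [hβ', ← Finset.sum_coe_sort T', ← e.sum_comp]
      exact Finset.sum_congr rfl fun i _ => mul_comm _ _
  -- sum and swap
  rw [← mk_eq_zero_iff, map_sum]
  change ∑ j, cl (V j) = 0
  simp_rw [hcl]
  rw [Finset.sum_comm]
  refine Finset.sum_eq_zero fun i _ => ?_
  exact (⟨T, κ i, hT, hκ i, hκi i⟩ : Base m).constAngleFold_exact Finset.univ (fun j => g i j) d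
    (fun j _ => (hd j).le) (fun j _ => hds j) (hv (e i))

/-- **CAF\*.** As `constAngleFold_pos`, allowing `d_j = 0` (those monomials are null). -/
theorem constAngleFold {m : ℕ} {T : Set (Fin m → ℝ)} (hT : IsSemialgebraic ℚ T) {ι : Type*} [Fintype ι]
    [DecidableEq ι] (d : ι → ℝ) (p : ι → (Fin m → ℝ) → ℝ) (V : ι → KZ.IntegralRep (m + 1))
    (hd : ∀ j, 0 ≤ d j) (hds : ∀ j, SaConst T (d j)) (hp : ∀ j, IsSemialgebraicFunOn ℚ T (p j))
    (hVd : ∀ j, (V j).domain = KZlog.band T (fun _ => 0) (fun _ => d j))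
    (hVi : ∀ j, EqOn (V j).integrand (fun z => p j (Fin.init z) / (1 + z (Fin.last m) ^ 2)) (V j).domain)
    {S : ℕ} (f' : Fin S → ι → ℤ) (mS : Fin S → ℚ) (q' : Fin S → (Fin m → ℝ) → ℝ)
    (hrel : ∀ s, ∑ j, (f' s j : ℝ) * Real.arctan (d j) = (mS s : ℝ) * Real.pi)
    (hbud : ∀ x ∈ T, ∑ s, q' s x * (mS s : ℝ) = 0)
    (hpq : ∀ j, ∀ x ∈ T, p j x = ∑ s, q' s x * (f' s j : ℝ)) :
    ∑ j, KZ.of (V j) ∈ KZ.relations := by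
  classical
  -- the null monomials
  have hnull : ∀ j, d j = 0 → KZ.of (V j) ∈ KZ.relations := fun j hj =>
    KZ.of_mem_relations_of_volume_eq_zero _ (measure_mono_null (fun z hz => by
      rw [hVd j] at hz
      have h := (KZlog.mem_band.1 hz).2
      rw [hj] at h
      exact le_antisymm h.2 h.1) (KZ.volume_setOf_last_eq_zero (0:ℝ)))
  -- split the sum
  let ιp := {j : ι // 0 < d j}
  have hsplit : ∑ j, KZ.of (V j) = ∑ j : ιp, KZ.of (V j) + ∑ j ∈ Finset.univ.filter (fun j => ¬ 0 < d j), KZ.of (V j) := by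
    rw [← Finset.sum_filter_add_sum_filter_not Finset.univ (fun j => 0 < d j), Finset.sum_subtype]
    intro j; simp
  rw [hsplit]
  refine add_mem ?_ (sum_mem fun j hj => hnull j (le_antisymm (not_lt.1 (Finset.mem_filter.1 hj).2) (hd j)))
  refine constAngleFold_pos hT (fun j : ιp => d j) (fun j => p j) (fun j => V j) (fun j => j.2) (fun j => hds j)
    (fun j => hp j) (fun j => hVd j) (fun j => hVi j) (fun s (j : ιp) => f' s j) mS q' (fun s => ?_) hbud
    (fun j x hx => hpq j x hx)
  rw [← hrel s, ← Finset.sum_filter_add_sum_filter_not Finset.univ (fun j => 0 < d j), Finset.sum_subtype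
    (p := fun j => 0 < d j) (Finset.univ.filter fun j => 0 < d j) (fun j => by simp)]
  rw [Finset.sum_eq_zero (s := Finset.univ.filter fun j => ¬ 0 < d j) fun j hj => by
    rw [le_antisymm (not_lt.1 (Finset.mem_filter.1 hj).2) (hd j), Real.arctan_zero, mul_zero], add_zero]

/-! ### §B1 The substitution move (KZ rule 2) for fibre maps `z ↦ (init z, ψ z)` on an ARBITRARY `ℚ`-sa domain
(the tree's `of_sub_of_mem_relations_of_fibreMap'` (P49) minus its band-specific image/injectivity bookkeeping). -/

section Subst

variable {m : ℕ}

/-- Auxiliary step `eq_snoc_init_zero_add''` (§B1): eq snoc init zero add''. [bookkeeping] -/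
private theorem eq_snoc_init_zero_add'' (m : ℕ) (w : Fin (m + 1) → ℝ) :
    w = Fin.snoc (Fin.init w) (0 : ℝ) + w (Fin.last m) • (Pi.single (Fin.last m) (1 : ℝ) : Fin (m + 1) → ℝ) := by
  ext i
  refine Fin.lastCases ?_ (fun j => ?_) i
  · simp
  · simp [(Fin.castSucc_lt_last j).ne, Fin.init]

/-- The substitution map `z ↦ (init z, ψ z)`. -/
def substMap (ψ : (Fin (m + 1) → ℝ) → ℝ) : (Fin (m + 1) → ℝ) → (Fin (m + 1) → ℝ) :=
  fun z => Fin.snoc (Fin.init z) (ψ z)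

/-- Auxiliary step `substMap_apply` (§B1): subst Map apply. [bookkeeping] -/
theorem substMap_apply (ψ : (Fin (m + 1) → ℝ) → ℝ) (z : Fin (m + 1) → ℝ) :
    substMap ψ z = Fin.snoc (Fin.init z) (ψ z) := rfl

/-- Auxiliary step `init_substMap` (§B1): init subst Map. [bookkeeping] -/
@[simp] theorem init_substMap (ψ : (Fin (m + 1) → ℝ) → ℝ) (z : Fin (m + 1) → ℝ) :
    Fin.init (substMap ψ z) = Fin.init z := by
  simp [substMap]

/-- Auxiliary step `substMap_last` (§B1): subst Map last. [bookkeeping] -/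
@[simp] theorem substMap_last (ψ : (Fin (m + 1) → ℝ) → ℝ) (z : Fin (m + 1) → ℝ) :
    substMap ψ z (Fin.last m) = ψ z := by
  simp [substMap]

/-- Derivative and Jacobian determinant of the substitution map. -/
theorem subst_calculus (ψ ψs : (Fin (m + 1) → ℝ) → ℝ) (D : Set (Fin (m + 1) → ℝ))
    (hψd : ∀ z ∈ D, DifferentiableAt ℝ ψ z)
    (hψs : ∀ z ∈ D, HasDerivAt (fun t : ℝ => ψ (Fin.snoc (Fin.init z) t)) (ψs z) (z (Fin.last m))) :
    ∃ Φ' : (Fin (m + 1) → ℝ) → (Fin (m + 1) → ℝ) →L[ℝ] (Fin (m + 1) → ℝ),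
      (∀ z ∈ D, HasFDerivAt (substMap ψ) (Φ' z) z) ∧ (∀ z ∈ D, (Φ' z).det = ψs z) := by
  let Φ' : (Fin (m + 1) → ℝ) → (Fin (m + 1) → ℝ) →L[ℝ] (Fin (m + 1) → ℝ) := fun z =>
    ContinuousLinearMap.pi
      (Fin.lastCases (motive := fun _ => (Fin (m + 1) → ℝ) →L[ℝ] ℝ) (fderiv ℝ ψ z)
        (fun i => ContinuousLinearMap.proj (Fin.castSucc i)))
  have hΦ' : ∀ z w, Φ' z w = Fin.snoc (Fin.init w) (fderiv ℝ ψ z w) := by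
    intro z w
    funext i
    refine Fin.lastCases ?_ (fun j => ?_) i
    · simp [Φ']
    · simp [Φ', Fin.init]
  have hlast : ∀ z ∈ D, fderiv ℝ ψ z (Pi.single (Fin.last m) 1) = ψs z := by
    intro z hz
    have hγ : HasDerivAt (fun t : ℝ => (Fin.snoc (Fin.init z) t : Fin (m + 1) → ℝ))
        (Pi.single (Fin.last m) (1 : ℝ)) (z (Fin.last m)) := by
      rw [hasDerivAt_pi]
      intro i
      refine Fin.lastCases ?_ (fun j => ?_) i
      · simpa using hasDerivAt_id' (z (Fin.last m))
      · simpa [(Fin.castSucc_lt_last j).ne, Fin.init] using hasDerivAt_const (z (Fin.last m)) (z (Fin.castSucc j))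
    have h1 : HasDerivAt (fun t : ℝ => ψ (Fin.snoc (Fin.init z) t))
        (fderiv ℝ ψ z (Pi.single (Fin.last m) 1)) (z (Fin.last m)) := by
      have hψz : HasFDerivAt ψ (fderiv ℝ ψ z) (Fin.snoc (Fin.init z) (z (Fin.last m))) := by
        rw [Fin.snoc_init_self]
        exact (hψd z hz).hasFDerivAt
      exact hψz.comp_hasDerivAt (z (Fin.last m)) hγ
    exact h1.unique (hψs z hz)
  have hdet : ∀ z ∈ D, (Φ' z).det = ψs z := by
    intro z hz
    let E : (Fin m → ℝ) →ₗ[ℝ] (Fin (m + 1) → ℝ) :=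
      LinearMap.pi (Fin.lastCases (motive := fun _ => (Fin m → ℝ) →ₗ[ℝ] ℝ) 0
        (fun i => LinearMap.proj i))
    have hE : ∀ y, E y = Fin.snoc y 0 := by
      intro y
      funext i
      refine Fin.lastCases ?_ (fun j => ?_) i
      · simp [E]
      · simp [E]
    have h := LinearMap.det_of_snoc_init (Φ' z : (Fin (m + 1) → ℝ) →ₗ[ℝ] (Fin (m + 1) → ℝ))
      LinearMap.id ((fderiv ℝ ψ z : (Fin (m + 1) → ℝ) →ₗ[ℝ] ℝ).comp E)
      (fderiv ℝ ψ z (Pi.single (Fin.last m) 1)) (fun w => by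
        rw [ContinuousLinearMap.coe_coe, hΦ', LinearMap.id_apply, LinearMap.comp_apply,
          ContinuousLinearMap.coe_coe, hE]
        congr 1
        conv_lhs => rw [eq_snoc_init_zero_add'' m w]
        rw [map_add, map_smul, smul_eq_mul, mul_comm])
    rw [LinearMap.det_id, mul_one, hlast z hz] at h
    exact h
  have hderiv : ∀ z ∈ D, HasFDerivAt (substMap ψ) (Φ' z) z := by
    intro z hz
    rw [hasFDerivAt_pi']
    intro i
    refine Fin.lastCases ?_ (fun j => ?_) i
    · have hfun : (fun x => substMap ψ x (Fin.last m)) = ψ := by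
        funext x
        simp [substMap]
      show HasFDerivAt (fun x => substMap ψ x (Fin.last m)) _ z
      rw [hfun]
      refine (hψd z hz).hasFDerivAt.congr_fderiv (ContinuousLinearMap.ext fun w => ?_)
      simp [hΦ']
    · have hfun : (fun x => substMap ψ x (Fin.castSucc j)) = fun x => x (Fin.castSucc j) := by
        funext x
        simp [substMap, Fin.init]
      show HasFDerivAt (fun x => substMap ψ x (Fin.castSucc j)) _ z
      rw [hfun]
      refine (hasFDerivAt_apply (Fin.castSucc j) z).congr_fderiv
        (ContinuousLinearMap.ext fun w => ?_)
      simp [hΦ', Fin.init]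
  exact ⟨Φ', hderiv, hdet⟩

open MvPolynomial in
/-- Auxiliary step `isSemialgebraicMapOn_substMap` (§B1): is Semialgebraic Map On subst Map. [bookkeeping] -/
theorem isSemialgebraicMapOn_substMap {D : Set (Fin (m + 1) → ℝ)} (hD : IsSemialgebraic ℚ D)
    {ψ : (Fin (m + 1) → ℝ) → ℝ} (hψ : IsSemialgebraicFunOn ℚ D ψ) :
    IsSemialgebraicMapOn ℚ D (substMap ψ) := by
  refine (isSemialgebraicMapOn_iff_forall_holds hD).mpr fun i => ?_
  refine Fin.lastCases ?_ (fun j => ?_) i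
  · exact hψ.congr fun z _ => by simp [substMap]
  · exact (isSemialgebraicFunOn_aeval hD (MvPolynomial.X (Fin.castSucc j))).congr fun z _ => by
      simp [substMap, Fin.init]

/-- Auxiliary step `injOn_substMap` (§B1): inj On subst Map. [bookkeeping] -/
theorem injOn_substMap {D : Set (Fin (m + 1) → ℝ)} {ψ : (Fin (m + 1) → ℝ) → ℝ}
    (hinj : ∀ z₁ ∈ D, ∀ z₂ ∈ D, Fin.init z₁ = Fin.init z₂ → ψ z₁ = ψ z₂ →
      z₁ (Fin.last m) = z₂ (Fin.last m)) : InjOn (substMap ψ) D := by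
  intro z₁ hz₁ z₂ hz₂ h
  have hy : Fin.init z₁ = Fin.init z₂ := by
    have := congrArg Fin.init h
    simpa [substMap] using this
  have hl : ψ z₁ = ψ z₂ := by
    have := congrFun h (Fin.last m)
    simpa [substMap] using this
  rw [← Fin.snoc_init_self z₁, ← Fin.snoc_init_self z₂, hy, hinj z₁ hz₁ z₂ hz₂ hy hl]

end Subst
end AngleFold
end Summit.KontsevichZagierPeriods.RootDecompRelativeModAbsolute.Rung30571.RegularisedLogLayer.CylLog.Leaf.G13
end
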